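import Summits.QuantumFields.YangMills.Theorems.AllWindowsColdBoxBoxHighLineJacWeight
import Summits.QuantumFields.YangMills.Theorems.AllWindowsColdBoxBoxHighLineOrbitJacobianChange
import Summits.QuantumFields.YangMills.Theorems.AllWindowsColdBoxBoxHighLineLaplaceSandwichPauliFlat
import Summits.QuantumFields.YangMills.Theorems.AllWindowsColdBoxBoxHighLineSmearedFPWeight

/-!
# T-S5.4J ASSEMBLY CORE (builder ym-line-fcl-p3 g25): the two-sided bound on the Jacobian-weighted orbit normaliser
# `N_J(V) = orbitAverage H (jacWeight β H r) V` from the bricks J1 (Jacobian = FP determinant × Haar density), J2-shaped injectivity data,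
# J4-shaped surjectivity data, the far-region coercivity (J5a shape), a determinant ceiling (J5b shape) and the bulk cut-off (4p shape) —
# all entering as HYPOTHESES in their landed/typed letters; no window arithmetic here (that is the by-name wrapper's job).

Over ✓`…OrbitJacobianDefs` (task letters), w5's ✓`…JacWeight` (measurability of `jacWeight`), J3 ✓`…OrbitJacobianChange`, 4k-C ✓`…LaplaceSandwichPauliFlat`.
Route (`Cruxes/BoxWindowHighSU2213/TaskS5Laplace.lean`, planner ym-idea-2 g18): in flat Pauli coordinates (4k-C ✓`orbitAverage_eq_flat`) the integrand is
`pauliDensity·jacWeight = (2π²)^{−n'}·|det DΨ_V|·e^{−β|Ψ_V|²}·χ` on the chart (J1), so on the injectivity box `S₀` the Jacobian substitution (J3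
✓`setIntegral_image_eq`) gives the Gaussian `∫_{Ψ_V(S₀)} e^{−β|c|²} ≤ √(π/β)^{3n'}`; off `S₀` coercivity + the determinant ceiling give a constant times the
Haar probability; on the inner box `S₁` (cut-off ≡ 1) surjectivity onto a ball gives the Gaussian from below minus the norm tail.
* ★★★ `orbitNormaliser_upper_J`: `N_J(V) ≤ (2π²)^{−n'}·√(π/β)^{N} + D·e^{−β·c₅·a₀²/H⁴}` (`N = 3n'`).
* ★★★ `orbitNormaliser_lower_J`: `(2π²)^{−n'}·(√(π/β)^{N} − e^{−βρ²/2}·√(2π/β)^{N}) ≤ N_J(V)`.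

HONEST LABEL: assembly core with the lattice bricks as hypotheses; `OrbitNormaliserJacobian` BY NAME (window arithmetic + brick discharge) is NOT in
this file; T-S5.4J, S5 (LINE-19 ⟨stmt-QuantumFields-24004⟩/⟨24335⟩), U5 (⟨24336⟩, U5-window OPEN) and the items are OPEN; the Yang–Mills mass gap
is NOT proved by this file; no summit is proved by a line.
-/

set_option autoImplicit false

noncomputable section

open MeasureTheory Matrix Real Metric Set
open Literature.MathematicalPhysics.QuantumFieldTheory.AxialGauge (boxEdges)
open Literature.MathematicalPhysics.QuantumFieldTheory.Balaban1983to89.B10Eq22Rescaling (sigmaSU2)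
open Literature.MathematicalPhysics.QuantumFieldTheory.Balaban1983to89.B10Eq18SigmaSU2Haar (expPauli measurable_expPauli isProbabilityMeasure_sigmaMeasure sigmaMeasure)
open Literature.MathematicalPhysics.QuantumLattice (gaugeTransformZd LGConfig ZdEdge)
open Literature.Probability.LatticeModels (Site)

namespace Summit.QuantumFields.YangMills.Theorems.AllWindowsColdBoxBoxHighLine.OrbitJacobian

open LaplaceSandwich

variable (H : ℕ)

/-! ## §1 The flat integrand of `N_J` -/

/-- `vecToField = ♭⁻¹` (definitional). [folklore] -/
theorem vecToField_eq_flatten_symm (v : ↥(interiorSites H) × Fin 3 → ℝ) :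
    vecToField H v = (flatten ↥(interiorSites H)).symm v := rfl

/-- `landauPhi` along the orbit is the squared norm of the flat orbit map: `Φ(V^{pauliGauge (♭⁻¹v)}) = Ψ_V(v) ⬝ᵥ Ψ_V(v)`. [folklore] -/
theorem landauPhi_orbit_eq_dotProduct (V : LGConfig 4 SU2) (v : ↥(interiorSites H) × Fin 3 → ℝ) :
    landauPhi H (gaugeTransformZd (pauliGauge H ((flatten ↥(interiorSites H)).symm v)) V) = orbitMapFlat H V v ⬝ᵥ orbitMapFlat H V v := by
  unfold landauPhi
  rw [← Finset.sum_coe_sort (interiorSites H)]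
  simp only [dotProduct, Fintype.sum_prod_type, orbitMapFlat, vecToField_eq_flatten_symm, sq]

/-- ★ **Haar is a probability in flat Pauli coordinates**: `∫ v, pauliDensity(♭⁻¹ v) dv = 1`. [folklore] -/
theorem integral_pauliDensity_flat : ∫ v : ↥(interiorSites H) × Fin 3 → ℝ, pauliDensity ↥(interiorSites H) ((flatten ↥(interiorSites H)).symm v) = 1 := by
  haveI : ∀ _ : ↥(interiorSites H), IsProbabilityMeasure sigmaMeasure := fun _ => isProbabilityMeasure_sigmaMeasure
  haveI : IsProbabilityMeasure (Measure.pi fun _ : ↥(interiorSites H) => sigmaMeasure) := inferInstance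
  have h := integral_pi_sigmaMeasure_eq_flat ↥(interiorSites H) (fun _ => (1 : ℝ))
  simp only [mul_one, integral_const, smul_eq_mul, probReal_univ] at h
  exact h.symm

/-- The flat Haar density is integrable (its integral is `1 ≠ 0`). [folklore] -/
theorem integrable_pauliDensity_flat :
    Integrable fun v : ↥(interiorSites H) × Fin 3 → ℝ => pauliDensity ↥(interiorSites H) ((flatten ↥(interiorSites H)).symm v) :=
  Integrable.of_integral_ne_zero (by rw [integral_pauliDensity_flat]; exact one_ne_zero)

/-- Off the product of injectivity balls the density vanishes. [folklore] -/
theorem pauliDensity_eq_zero_of_pi_le {A : ↥(interiorSites H) → EuclideanSpace ℝ (Fin 3)} {x : ↥(interiorSites H)} (hx : Real.pi ≤ ‖A x‖) :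
    pauliDensity ↥(interiorSites H) A = 0 := by
  unfold pauliDensity
  rw [Set.indicator_of_notMem]
  intro hA
  have := hA x (Set.mem_univ x)
  rw [mem_ball_zero_iff] at this
  linarith

/-- ★ **`N_J` as a flat integral**: `orbitAverage H (jacWeight β H r) V = ∫ v, pauliDensity(♭⁻¹v)·jacWeight(V^{pauliGauge(♭⁻¹v)}) dv`. [folklore] -/
theorem orbitAverage_jacWeight_eq_flat (β r : ℝ) (V : LGConfig 4 SU2) :
    orbitAverage H (jacWeight β H r) V =
      ∫ v : ↥(interiorSites H) × Fin 3 → ℝ, pauliDensity ↥(interiorSites H) ((flatten ↥(interiorSites H)).symm v) *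
        jacWeight β H r (gaugeTransformZd (pauliGauge H ((flatten ↥(interiorSites H)).symm v)) V) :=
  orbitAverage_eq_flat H (measurable_jacWeight β H r) V

/-- On the chart domain the Haar density is the plain product `Π_x σ(‖A_x‖)`. [folklore] -/
theorem pauliDensity_eq_prod_of_lt_pi {A : ↥(interiorSites H) → EuclideanSpace ℝ (Fin 3)} (hA : ∀ x, ‖A x‖ < Real.pi) :
    pauliDensity ↥(interiorSites H) A = ∏ x, sigmaSU2 ‖A x‖ := by
  unfold pauliDensity
  rw [Set.indicator_of_mem]
  intro x _
  rw [mem_ball_zero_iff]; exact hA x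

/-- ★ **THE INTEGRAND IDENTITY (from J1)**: on the chart domain, `pauliDensity(A)·jacWeight(V^{pauliGauge A})
= (2π²)^{−n'}·|det DΨ_V(v)|·e^{−β Ψ_V(v)⬝Ψ_V(v)}·χ(V^{pauliGauge A})`, `A = ♭⁻¹v`. [folklore] -/
theorem integrand_eq_of_lt_pi (hJ1 : OrbitMapJacobianDet) (β r : ℝ) (V : LGConfig 4 SU2) (v : ↥(interiorSites H) × Fin 3 → ℝ)
    (hv : ∀ x, ‖(flatten ↥(interiorSites H)).symm v x‖ < Real.pi) :
    pauliDensity ↥(interiorSites H) ((flatten ↥(interiorSites H)).symm v) *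
        jacWeight β H r (gaugeTransformZd (pauliGauge H ((flatten ↥(interiorSites H)).symm v)) V) =
      ((2 * Real.pi ^ 2) ^ (interiorSites H).card)⁻¹ * |(fderiv ℝ (orbitMapFlat H V) v).det| *
        (Real.exp (-(β * (orbitMapFlat H V v ⬝ᵥ orbitMapFlat H V v))) *
          ballCutoff H r (gaugeTransformZd (pauliGauge H ((flatten ↥(interiorSites H)).symm v)) V)) := by
  have hdet := (hJ1 H V v).2
  rw [vecToField_eq_flatten_symm] at hdet
  rw [jacWeight, fpWeight, landauPhi_orbit_eq_dotProduct, pauliDensity_eq_prod_of_lt_pi H hv, hdet, Finset.prod_mul_distrib,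
    Finset.prod_const, Finset.card_univ, Fintype.card_coe]
  have h2π : (2 * Real.pi ^ 2) ^ (interiorSites H).card ≠ 0 := by positivity
  field_simp

/-- Off the chart domain the integrand vanishes (the Haar density carries the indicator of the injectivity balls). [folklore] -/
theorem integrand_eq_zero_of_pi_le (β r : ℝ) (V : LGConfig 4 SU2) (v : ↥(interiorSites H) × Fin 3 → ℝ)
    {x : ↥(interiorSites H)} (hx : Real.pi ≤ ‖(flatten ↥(interiorSites H)).symm v x‖) :
    pauliDensity ↥(interiorSites H) ((flatten ↥(interiorSites H)).symm v) *
        jacWeight β H r (gaugeTransformZd (pauliGauge H ((flatten ↥(interiorSites H)).symm v)) V) = 0 := by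
  rw [pauliDensity_eq_zero_of_pi_le H hx, zero_mul]

/-- The flat integrand of `N_J` is integrable once the determinant factor is bounded (`|det F(W)| ≤ D` for all `W`, J5b) and `β ≥ 0`. [folklore] -/
theorem integrable_integrand {β : ℝ} (hβ : 0 ≤ β) (r : ℝ) (V : LGConfig 4 SU2) {D : ℝ}
    (hdet : ∀ W : LGConfig 4 SU2, |(fpOperator H W).det| ≤ D) :
    Integrable fun v : ↥(interiorSites H) × Fin 3 → ℝ => pauliDensity ↥(interiorSites H) ((flatten ↥(interiorSites H)).symm v) *
      jacWeight β H r (gaugeTransformZd (pauliGauge H ((flatten ↥(interiorSites H)).symm v)) V) := by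
  have hD : 0 ≤ D := (abs_nonneg _).trans (hdet 1)
  have hmeas : Measurable fun v : ↥(interiorSites H) × Fin 3 → ℝ =>
      jacWeight β H r (gaugeTransformZd (pauliGauge H ((flatten ↥(interiorSites H)).symm v)) V) := by
    have h1 := measurable_orbitIntegrand H (measurable_jacWeight β H r) V
    have h2 : Measurable fun (A : ↥(interiorSites H) → EuclideanSpace ℝ (Fin 3)) (x : ↥(interiorSites H)) =>
        expPauli (A x) :=
      measurable_pi_lambda _ fun x => measurable_expPauli.comp (measurable_pi_apply x)
    exact (h1.comp h2).comp (flatten ↥(interiorSites H)).symm.measurable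
  refine (integrable_pauliDensity_flat H).mul_bdd hmeas.aestronglyMeasurable (ae_of_all _ fun v => ?_) (c := D)
  rw [Real.norm_eq_abs, abs_of_nonneg (jacWeight_nonneg β H r _), jacWeight]
  calc fpWeight β H r _ * |(fpOperator H _).det| ≤ 1 * D :=
        mul_le_mul (fpWeight_le_one hβ H r _) (hdet _) (abs_nonneg _) zero_le_one
    _ = D := one_mul D

/-! ## §2 The upper bound -/

/-- The site box `{v | ∀ x, ‖(♭⁻¹v) x‖ ≤ a}` is convex, closed and measurable. [folklore] -/
theorem box_convex_measurable (a : ℝ) :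
    Convex ℝ {v : ↥(interiorSites H) × Fin 3 → ℝ | ∀ x, ‖(flatten ↥(interiorSites H)).symm v x‖ ≤ a} ∧
      MeasurableSet {v : ↥(interiorSites H) × Fin 3 → ℝ | ∀ x, ‖(flatten ↥(interiorSites H)).symm v x‖ ≤ a} := by
  have hlin : ∀ x : ↥(interiorSites H), ∃ L : (↥(interiorSites H) × Fin 3 → ℝ) →ₗ[ℝ] EuclideanSpace ℝ (Fin 3),
      ∀ v, L v = (flatten ↥(interiorSites H)).symm v x := by
    intro x
    refine ⟨{ toFun := fun v => (flatten ↥(interiorSites H)).symm v x, map_add' := fun v w => ?_, map_smul' := fun c v => ?_ }, fun v => rfl⟩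
    · ext c; rfl
    · ext c; rfl
  have hset : {v : ↥(interiorSites H) × Fin 3 → ℝ | ∀ x, ‖(flatten ↥(interiorSites H)).symm v x‖ ≤ a} =
      ⋂ x, {v | ‖(flatten ↥(interiorSites H)).symm v x‖ ≤ a} := by ext v; simp
  rw [hset]
  constructor
  · refine convex_iInter fun x => ?_
    obtain ⟨L, hL⟩ := hlin x
    have : {v : ↥(interiorSites H) × Fin 3 → ℝ | ‖(flatten ↥(interiorSites H)).symm v x‖ ≤ a} = L ⁻¹' Metric.closedBall 0 a := by
      ext v; simp [hL]
    rw [this]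
    exact (convex_closedBall _ _).linear_preimage L
  · refine MeasurableSet.iInter fun x => measurableSet_le ?_ measurable_const
    obtain ⟨L, hL⟩ := hlin x
    have hc : Continuous fun v : ↥(interiorSites H) × Fin 3 → ℝ => (flatten ↥(interiorSites H)).symm v x := by
      have := L.continuous_of_finiteDimensional
      exact this.congr (fun v => hL v)
    exact hc.norm.measurable

/-- ★★★ **UPPER BOUND.**  Hypotheses (letters of the bricks): J1; `F_V = fpOperator H V` invertible; the J2-contraction with constant `½` on the box
`S₀ = {∀ x, ‖A_x‖ ≤ a₀}` (`0 < a₀ < π`); the far-region coercivity `c₅‖A x₀‖² ≤ H⁴Φ` for moved configurations in the `4r²`-ball (J5a shape); the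
determinant ceiling `|det F(W)| ≤ D` (J5b shape); `β > 0`.  Then
`N_J(V) ≤ (2π²)^{−n'}·√(π/β)^{N} + D·exp(−β·c₅·a₀²/H⁴)`, `N = |interiorSites H × Fin 3|`. [folklore] -/
theorem orbitNormaliser_upper_J (hJ1 : OrbitMapJacobianDet) {β r a₀ c₅ D : ℝ} (hβ : 0 < β) (ha₀ : 0 < a₀) (ha₀π : a₀ < Real.pi)
    (V : LGConfig 4 SU2) (hF : IsUnit (fpOperator H V).det)
    (hcontr : ∀ v : ↥(interiorSites H) × Fin 3 → ℝ, (∀ x, ‖(flatten ↥(interiorSites H)).symm v x‖ ≤ a₀) →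
      ∀ w : ↥(interiorSites H) × Fin 3 → ℝ,
        (w - (fpOperator H V)⁻¹ *ᵥ (fderiv ℝ (orbitMapFlat H V) v w)) ⬝ᵥ (w - (fpOperator H V)⁻¹ *ᵥ (fderiv ℝ (orbitMapFlat H V) v w)) ≤
          ((1/2 : NNReal) : ℝ) ^ 2 * (w ⬝ᵥ w))
    (hfar : ∀ A : ↥(interiorSites H) → EuclideanSpace ℝ (Fin 3),
      (∀ e ∈ boxEdges 4 (2 * H + 1), linkDefect (gaugeTransformZd (pauliGauge H A) V) e < 4 * r ^ 2) → (∀ x, ‖A x‖ ≤ Real.pi) →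
        ∀ x₀, c₅ * ‖A x₀‖ ^ 2 ≤ (H : ℝ) ^ 4 * landauPhi H (gaugeTransformZd (pauliGauge H A) V))
    (hdet : ∀ W : LGConfig 4 SU2, |(fpOperator H W).det| ≤ D) :
    orbitAverage H (jacWeight β H r) V ≤
      ((2 * Real.pi ^ 2) ^ (interiorSites H).card)⁻¹ * Real.sqrt (Real.pi / β) ^ Fintype.card (↥(interiorSites H) × Fin 3) +
        D * Real.exp (-(β * (c₅ * a₀ ^ 2 / (H : ℝ) ^ 4))) := by
  set ι := ↥(interiorSites H) × Fin 3 with hι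
  set K : ℝ := ((2 * Real.pi ^ 2) ^ (interiorSites H).card)⁻¹ with hK_def
  have hK : 0 ≤ K := by positivity
  set f := orbitMapFlat H V with hf_def
  set Ψ : (ι → ℝ) → ℝ := fun v => pauliDensity ↥(interiorSites H) ((flatten ↥(interiorSites H)).symm v) *
    jacWeight β H r (gaugeTransformZd (pauliGauge H ((flatten ↥(interiorSites H)).symm v)) V) with hΨ_def
  have hΨ0 : ∀ v, 0 ≤ Ψ v := fun v => mul_nonneg (pauliDensity_nonneg_le _ _).1 (jacWeight_nonneg β H r _)
  have hΨi : Integrable Ψ := integrable_integrand H hβ.le r V hdet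
  set S₀ : Set (ι → ℝ) := {v | ∀ x, ‖(flatten ↥(interiorSites H)).symm v x‖ ≤ a₀} with hS₀_def
  obtain ⟨hS₀c, hS₀m⟩ := box_convex_measurable H a₀
  have hD : 0 ≤ D := (abs_nonneg _).trans (hdet 1)
  -- differentiability and injectivity on `S₀`
  have hdiff : ∀ v ∈ S₀, HasFDerivWithinAt f (fderiv ℝ f v) S₀ v := fun v _ => (hJ1 H V v).1.hasFDerivAt.hasFDerivWithinAt
  have hinj : InjOn f S₀ := injOn_of_contraction hS₀c hdiff hF (K := 1/2) (by norm_num) hcontr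
  -- the Gaussian in the image coordinates
  set g : (ι → ℝ) → ℝ := fun c => Real.exp (-(β * (c ⬝ᵥ c))) with hg_def
  have hgi : Integrable g := integrable_exp_neg_mul_dotProduct_self hβ
  have hchange : ∫ c in f '' S₀, g c = ∫ v in S₀, |(fderiv ℝ f v).det| * g (f v) := setIntegral_image_eq hS₀m hdiff hinj g
  have hjac_int : IntegrableOn (fun v => |(fderiv ℝ f v).det| * g (f v)) S₀ := by
    have := (integrableOn_image_iff_integrableOn_abs_det_fderiv_smul volume hS₀m hdiff hinj g).1 hgi.integrableOn
    simpa only [smul_eq_mul] using this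
  -- pointwise on `S₀`: Ψ ≤ K · |det Df| · g(f v)
  have hbulk : ∀ v ∈ S₀, Ψ v ≤ K * (|(fderiv ℝ f v).det| * g (f v)) := by
    intro v hv
    have hvπ : ∀ x, ‖(flatten ↥(interiorSites H)).symm v x‖ < Real.pi := fun x => lt_of_le_of_lt (hv x) ha₀π
    have hid := integrand_eq_of_lt_pi H hJ1 β r V v hvπ
    rw [hΨ_def]; dsimp only; rw [hid]
    have hχ := ballCutoff_le_one H r (gaugeTransformZd (pauliGauge H ((flatten ↥(interiorSites H)).symm v)) V)
    have hχ0 := ballCutoff_nonneg H r (gaugeTransformZd (pauliGauge H ((flatten ↥(interiorSites H)).symm v)) V)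
    have h1 : 0 ≤ K * |(fderiv ℝ f v).det| * g (f v) := by positivity
    calc K * |(fderiv ℝ (orbitMapFlat H V) v).det| * (Real.exp (-(β * (orbitMapFlat H V v ⬝ᵥ orbitMapFlat H V v))) *
          ballCutoff H r (gaugeTransformZd (pauliGauge H ((flatten ↥(interiorSites H)).symm v)) V))
        ≤ K * |(fderiv ℝ f v).det| * (g (f v) * 1) := by
          refine mul_le_mul_of_nonneg_left (mul_le_mul_of_nonneg_left hχ (Real.exp_pos _).le) (by positivity)
      _ = K * (|(fderiv ℝ f v).det| * g (f v)) := by ring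
  -- pointwise off `S₀`: Ψ ≤ D·e^{−βc₅a₀²/H⁴}·pauliDensity
  have hfar' : ∀ v ∈ S₀ᶜ, Ψ v ≤ D * Real.exp (-(β * (c₅ * a₀ ^ 2 / (H : ℝ) ^ 4))) *
      pauliDensity ↥(interiorSites H) ((flatten ↥(interiorSites H)).symm v) := by
    intro v hv
    set A := (flatten ↥(interiorSites H)).symm v with hA_def
    have hrhs : 0 ≤ D * Real.exp (-(β * (c₅ * a₀ ^ 2 / (H : ℝ) ^ 4))) * pauliDensity ↥(interiorSites H) A :=
      mul_nonneg (mul_nonneg hD (Real.exp_pos _).le) (pauliDensity_nonneg_le _ _).1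
    by_cases hπ : ∀ x, ‖A x‖ < Real.pi
    swap
    · push Not at hπ
      obtain ⟨x, hx⟩ := hπ
      rw [show Ψ v = 0 from integrand_eq_zero_of_pi_le H β r V v hx]
      exact hrhs
    by_cases hχ : ballCutoff H r (gaugeTransformZd (pauliGauge H A) V) = 0
    · have : Ψ v = 0 := by
        show pauliDensity ↥(interiorSites H) A * jacWeight β H r (gaugeTransformZd (pauliGauge H A) V) = 0
        rw [jacWeight, fpWeight, hχ, mul_zero, zero_mul, mul_zero]
      rw [this]; exact hrhs
    -- far: some site has ‖A x₀‖ > a₀, links in the 4r²-ball, coercivity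
    have hx₀ : ∃ x₀, a₀ < ‖A x₀‖ := by
      by_contra hcon
      push Not at hcon
      exact hv hcon
    obtain ⟨x₀, hx₀⟩ := hx₀
    have hlinks : ∀ e ∈ boxEdges 4 (2 * H + 1), linkDefect (gaugeTransformZd (pauliGauge H A) V) e < 4 * r ^ 2 :=
      fun e he => linkDefect_lt_of_ballCutoff_ne_zero hχ he
    have hΦ := hfar A hlinks (fun x => (hπ x).le) x₀
    have hH4 : 0 < (H : ℝ) ^ 4 ∨ (H : ℝ) ^ 4 = 0 := by
      rcases Nat.eq_zero_or_pos H with h0 | h0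
      · right; simp [h0]
      · left; positivity
    have hΦge : c₅ * a₀ ^ 2 / (H : ℝ) ^ 4 ≤ landauPhi H (gaugeTransformZd (pauliGauge H A) V) := by
      rcases hH4 with h4 | h4
      · rw [div_le_iff₀ h4]
        have : c₅ * a₀ ^ 2 ≤ c₅ * ‖A x₀‖ ^ 2 ∨ c₅ < 0 := by
          rcases le_or_gt 0 c₅ with hc | hc
          · left; exact mul_le_mul_of_nonneg_left (pow_le_pow_left₀ ha₀.le hx₀.le 2) hc
          · right; exact hc
        rcases this with h | h
        · calc c₅ * a₀ ^ 2 ≤ c₅ * ‖A x₀‖ ^ 2 := h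
            _ ≤ (H : ℝ) ^ 4 * landauPhi H _ := hΦ
            _ = landauPhi H _ * (H : ℝ) ^ 4 := mul_comm _ _
        · have := landauPhi_nonneg H (gaugeTransformZd (pauliGauge H A) V)
          nlinarith [sq_nonneg a₀]
      · rw [h4, div_zero]; exact landauPhi_nonneg H _
    have hw : jacWeight β H r (gaugeTransformZd (pauliGauge H A) V) ≤ D * Real.exp (-(β * (c₅ * a₀ ^ 2 / (H : ℝ) ^ 4))) := by
      rw [jacWeight, fpWeight]
      calc Real.exp (-(β * landauPhi H _)) * ballCutoff H r _ * |(fpOperator H _).det|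
          ≤ Real.exp (-(β * (c₅ * a₀ ^ 2 / (H : ℝ) ^ 4))) * 1 * D := by
            refine mul_le_mul (mul_le_mul (Real.exp_le_exp.2 (by nlinarith)) (ballCutoff_le_one H r _) (ballCutoff_nonneg H r _)
              (Real.exp_pos _).le) (hdet _) (abs_nonneg _) (by positivity)
        _ = D * Real.exp (-(β * (c₅ * a₀ ^ 2 / (H : ℝ) ^ 4))) := by ring
    calc Ψ v = pauliDensity ↥(interiorSites H) A * jacWeight β H r (gaugeTransformZd (pauliGauge H A) V) := rfl
      _ ≤ pauliDensity ↥(interiorSites H) A * (D * Real.exp (-(β * (c₅ * a₀ ^ 2 / (H : ℝ) ^ 4)))) :=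
          mul_le_mul_of_nonneg_left hw (pauliDensity_nonneg_le _ _).1
      _ = _ := by ring
  -- assemble
  rw [orbitAverage_jacWeight_eq_flat, ← integral_add_compl hS₀m hΨi]
  have hpd := integrable_pauliDensity_flat H
  have h1 : ∫ v in S₀, Ψ v ≤ K * Real.sqrt (Real.pi / β) ^ Fintype.card ι := by
    calc ∫ v in S₀, Ψ v ≤ ∫ v in S₀, K * (|(fderiv ℝ f v).det| * g (f v)) :=
          setIntegral_mono_on hΨi.integrableOn (hjac_int.const_mul K) hS₀m hbulk
      _ = K * ∫ c in f '' S₀, g c := by rw [integral_const_mul, hchange]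
      _ ≤ K * Real.sqrt (Real.pi / β) ^ Fintype.card ι := by
          refine mul_le_mul_of_nonneg_left ?_ hK
          exact (setIntegral_exp_neg_mul_dotProduct_self_mono hβ (subset_univ (f '' S₀))).1.trans
            (by rw [Measure.restrict_univ]; exact le_of_eq (integral_exp_neg_mul_dotProduct_self hβ))
  have h2 : ∫ v in S₀ᶜ, Ψ v ≤ D * Real.exp (-(β * (c₅ * a₀ ^ 2 / (H : ℝ) ^ 4))) := by
    calc ∫ v in S₀ᶜ, Ψ v ≤ ∫ v in S₀ᶜ, D * Real.exp (-(β * (c₅ * a₀ ^ 2 / (H : ℝ) ^ 4))) *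
          pauliDensity ↥(interiorSites H) ((flatten ↥(interiorSites H)).symm v) :=
          setIntegral_mono_on hΨi.integrableOn (hpd.const_mul _).integrableOn hS₀m.compl hfar'
      _ = D * Real.exp (-(β * (c₅ * a₀ ^ 2 / (H : ℝ) ^ 4))) * ∫ v in S₀ᶜ, pauliDensity ↥(interiorSites H) ((flatten ↥(interiorSites H)).symm v) :=
          integral_const_mul _ _
      _ ≤ D * Real.exp (-(β * (c₅ * a₀ ^ 2 / (H : ℝ) ^ 4))) * 1 := by
          refine mul_le_mul_of_nonneg_left ?_ (mul_nonneg hD (Real.exp_pos _).le)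
          rw [← integral_pauliDensity_flat H]
          exact setIntegral_le_integral hpd (ae_of_all _ fun v => (pauliDensity_nonneg_le _ _).1)
      _ = _ := mul_one _
  linarith

/-! ## §3 The lower bound -/

/-- ★★★ **LOWER BOUND.**  Hypotheses: J1; `F_V` invertible; the J2-contraction (constant `½`) on `S₀ = {∀x, ‖A_x‖ ≤ a₀}`, `0 < a₀ < π`; an inner radius
`a₁ ≤ a₀` on whose box the cut-off is identically `1` (4p shape) and from which the orbit map reaches every `c` with `c⬝c ≤ ρ²` (J4 shape); `β > 0`.
Then `(2π²)^{−n'}·(√(π/β)^{N} − e^{−βρ²/2}·√(2π/β)^{N}) ≤ N_J(V)`. [folklore] -/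
theorem orbitNormaliser_lower_J (hJ1 : OrbitMapJacobianDet) {β r a₀ a₁ ρ D : ℝ} (hβ : 0 < β) (ha₀π : a₀ < Real.pi) (ha₁ : a₁ ≤ a₀)
    (V : LGConfig 4 SU2) (hF : IsUnit (fpOperator H V).det)
    (hcontr : ∀ v : ↥(interiorSites H) × Fin 3 → ℝ, (∀ x, ‖(flatten ↥(interiorSites H)).symm v x‖ ≤ a₀) →
      ∀ w : ↥(interiorSites H) × Fin 3 → ℝ,
        (w - (fpOperator H V)⁻¹ *ᵥ (fderiv ℝ (orbitMapFlat H V) v w)) ⬝ᵥ (w - (fpOperator H V)⁻¹ *ᵥ (fderiv ℝ (orbitMapFlat H V) v w)) ≤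
          ((1/2 : NNReal) : ℝ) ^ 2 * (w ⬝ᵥ w))
    (hcut : ∀ A : ↥(interiorSites H) → EuclideanSpace ℝ (Fin 3), (∀ x, ‖A x‖ ≤ a₁) →
      ballCutoff H r (gaugeTransformZd (pauliGauge H A) V) = 1)
    (hsurj : ∀ c : ↥(interiorSites H) × Fin 3 → ℝ, c ⬝ᵥ c ≤ ρ ^ 2 →
      ∃ v : ↥(interiorSites H) × Fin 3 → ℝ, (∀ x, ‖vecToField H v x‖ ≤ a₁) ∧ orbitMapFlat H V v = c)
    (hdet : ∀ W : LGConfig 4 SU2, |(fpOperator H W).det| ≤ D) :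
    ((2 * Real.pi ^ 2) ^ (interiorSites H).card)⁻¹ *
        (Real.sqrt (Real.pi / β) ^ Fintype.card (↥(interiorSites H) × Fin 3) -
          Real.exp (-(β * ρ ^ 2 / 2)) * Real.sqrt (2 * Real.pi / β) ^ Fintype.card (↥(interiorSites H) × Fin 3)) ≤
      orbitAverage H (jacWeight β H r) V := by
  set ι := ↥(interiorSites H) × Fin 3 with hι
  set K : ℝ := ((2 * Real.pi ^ 2) ^ (interiorSites H).card)⁻¹ with hK_def
  have hK : 0 ≤ K := by positivity
  set f := orbitMapFlat H V with hf_def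
  set Ψ : (ι → ℝ) → ℝ := fun v => pauliDensity ↥(interiorSites H) ((flatten ↥(interiorSites H)).symm v) *
    jacWeight β H r (gaugeTransformZd (pauliGauge H ((flatten ↥(interiorSites H)).symm v)) V) with hΨ_def
  have hΨ0 : ∀ v, 0 ≤ Ψ v := fun v => mul_nonneg (pauliDensity_nonneg_le _ _).1 (jacWeight_nonneg β H r _)
  have hΨi : Integrable Ψ := integrable_integrand H hβ.le r V hdet
  set S₀ : Set (ι → ℝ) := {v | ∀ x, ‖(flatten ↥(interiorSites H)).symm v x‖ ≤ a₀} with hS₀_def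
  set S₁ : Set (ι → ℝ) := {v | ∀ x, ‖(flatten ↥(interiorSites H)).symm v x‖ ≤ a₁} with hS₁_def
  obtain ⟨hS₀c, hS₀m⟩ := box_convex_measurable H a₀
  obtain ⟨_, hS₁m⟩ := box_convex_measurable H a₁
  have hS₁₀ : S₁ ⊆ S₀ := fun v hv x => (hv x).trans ha₁
  have hdiff₀ : ∀ v ∈ S₀, HasFDerivWithinAt f (fderiv ℝ f v) S₀ v := fun v _ => (hJ1 H V v).1.hasFDerivAt.hasFDerivWithinAt
  have hinj₀ : InjOn f S₀ := injOn_of_contraction hS₀c hdiff₀ hF (K := 1/2) (by norm_num) hcontr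
  have hdiff₁ : ∀ v ∈ S₁, HasFDerivWithinAt f (fderiv ℝ f v) S₁ v := fun v _ => (hJ1 H V v).1.hasFDerivAt.hasFDerivWithinAt
  have hinj₁ : InjOn f S₁ := hinj₀.mono hS₁₀
  set g : (ι → ℝ) → ℝ := fun c => Real.exp (-(β * (c ⬝ᵥ c))) with hg_def
  have hgi : Integrable g := integrable_exp_neg_mul_dotProduct_self hβ
  have hchange : ∫ c in f '' S₁, g c = ∫ v in S₁, |(fderiv ℝ f v).det| * g (f v) := setIntegral_image_eq hS₁m hdiff₁ hinj₁ g
  have hjac_int : IntegrableOn (fun v => |(fderiv ℝ f v).det| * g (f v)) S₁ := by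
    have := (integrableOn_image_iff_integrableOn_abs_det_fderiv_smul volume hS₁m hdiff₁ hinj₁ g).1 hgi.integrableOn
    simpa only [smul_eq_mul] using this
  -- on `S₁` the integrand IS `K·|det Df|·g∘f`
  have hbulk : ∀ v ∈ S₁, K * (|(fderiv ℝ f v).det| * g (f v)) = Ψ v := by
    intro v hv
    have hvπ : ∀ x, ‖(flatten ↥(interiorSites H)).symm v x‖ < Real.pi := fun x => lt_of_le_of_lt ((hv x).trans ha₁) ha₀π
    have hid := integrand_eq_of_lt_pi H hJ1 β r V v hvπ
    rw [hΨ_def]; dsimp only; rw [hid, hcut _ hv]; ring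
  -- the ball is inside the image
  have hball : {c : ι → ℝ | c ⬝ᵥ c ≤ ρ ^ 2} ⊆ f '' S₁ := by
    intro c hc
    obtain ⟨v, hv, hfv⟩ := hsurj c hc
    exact ⟨v, fun x => by rw [← vecToField_eq_flatten_symm]; exact hv x, hfv⟩
  rw [orbitAverage_jacWeight_eq_flat]
  calc K * (Real.sqrt (Real.pi / β) ^ Fintype.card ι - Real.exp (-(β * ρ ^ 2 / 2)) * Real.sqrt (2 * Real.pi / β) ^ Fintype.card ι)
      ≤ K * ∫ c in {c : ι → ℝ | c ⬝ᵥ c ≤ ρ ^ 2}, g c :=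
        mul_le_mul_of_nonneg_left (setIntegral_exp_neg_mul_dotProduct_self_ball_ge hβ ρ) hK
    _ ≤ K * ∫ c in f '' S₁, g c := mul_le_mul_of_nonneg_left (setIntegral_exp_neg_mul_dotProduct_self_mono hβ hball).1 hK
    _ = ∫ v in S₁, K * (|(fderiv ℝ f v).det| * g (f v)) := by rw [hchange, integral_const_mul]
    _ = ∫ v in S₁, Ψ v := setIntegral_congr_fun hS₁m hbulk
    _ ≤ ∫ v, Ψ v := setIntegral_le_integral hΨi (ae_of_all _ hΨ0)

end Summit.QuantumFields.YangMills.Theorems.AllWindowsColdBoxBoxHighLine.OrbitJacobian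

end
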